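import Summits.BirchSwinnertonDyer.Rank1Residual.Supersingular.RankOneRem13RecordShapesCount
import HarnessLib

/-!
# A kernel-cheap point count: `countPointsFast` (Euler's criterion by BINARY modular exponentiation)
# = the schema's `countPoints` — lifts the `ℓ ≲ 911` memory ceiling of per-pair kernel point counts (TOOL)

Cell `b2b-bsdres`, supersingular family, prover A = unit `b2b-bsdres-x10b` (gen 12).  Topic file; namespace
`Summit.BirchSwinnertonDyer.Rank1Residual.Supersingular`.  TOOL: three small definitions (`powModFast`,
`legendreSymFast`, `countPointsFast`) and their agreement with the schema functions of
`Literature/…/X11RankOneCertificates/Schema.lean` (x11c's `X11b.powMod_eq` reused); no named fact, nothing booked.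

HONEST FRAMING (run/shared/lean/b2b/bsd-rank1-residual/, verbatim): the goal of the cell is to DELETE the
COMBINATION-SHAPED residual classes of the BSD formula in analytic rank `≤ 1` from PUBLISHED theorems only
and to TYPE the construction-shaped ones; this is not "finishing BSD".

## Why

The schema's `powMod b e m` multiplies `e` times (`List.foldl` over `List.range e`), so `countPoints a ℓ`
costs `≈ ℓ²/2` kernel multiplications; `decide +kernel` runs out of memory at `ℓ ≈ 950` ("(kernel) excessive
memory consumption" at `ℓ = 967`; additive-p3 GEN 20 kept `#Ẽ(𝔽_p)` as a binder `hn` on 93 rows with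
`p ≥ 1031` for this reason; 9 N4 cells have Kolyvagin primes in `[967, 4759]`).  `powModFast` squares-and-
multiplies (`≈ log₂ e` steps), `countPointsFast` is `countPoints` with it, and `countPoints_eq_of_fast` turns
a `decide`d `countPointsFast a ℓ = n` into the `countPoints a ℓ = n` every record shape consumes.
-/

namespace Summit.BirchSwinnertonDyer.Rank1Residual.Supersingular

open Literature.NumberTheory.EllipticCurves.Rank1Residual
open Literature.NumberTheory.EllipticCurves.Rank1Residual.X11RankOneCertificates (powMod countPoints)

/-- Binary modular exponentiation with structural fuel: `b^e mod m` whenever `e < 2^fuel`. [folklore] -/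
def powModFast : ℕ → ℕ → ℕ → ℕ → ℕ
  | 0, _, _, m => 1 % m
  | fuel + 1, b, e, m =>
    if e = 0 then 1 % m
    else
      let h := powModFast fuel b (e / 2) m
      if e % 2 = 0 then h * h % m else h * h % m * b % m

/-- `powModFast fuel b e m = b^e % m` for `e < 2^fuel`. [folklore] -/
theorem powModFast_eq : ∀ (fuel b e m : ℕ), e < 2 ^ fuel → powModFast fuel b e m = b ^ e % m
  | 0, b, e, m, he => by
    have : e = 0 := by simpa using he
    subst this; simp [powModFast]
  | fuel + 1, b, e, m, he => by
    rw [powModFast]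
    split_ifs with h0 h2
    · subst h0; simp
    · have ih := powModFast_eq fuel b (e / 2) m (by omega)
      simp only [ih]
      have he2 : e = e / 2 + e / 2 := by omega
      conv_rhs => rw [he2, pow_add]
      exact (Nat.mul_mod _ _ _).symm
    · have ih := powModFast_eq fuel b (e / 2) m (by omega)
      simp only [ih]
      have he2 : e = e / 2 + e / 2 + 1 := by omega
      have h1 : b ^ e % m = (b ^ (e / 2) * b ^ (e / 2)) % m * (b % m) % m := by
        conv_lhs => rw [he2, pow_succ, pow_add]
        exact Nat.mul_mod _ _ _
      have h2 : (b ^ (e / 2) * b ^ (e / 2)) % m = b ^ (e / 2) % m * (b ^ (e / 2) % m) % m := Nat.mul_mod _ _ _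
      rw [h1, h2, Nat.mul_mod (b ^ (e / 2) % m * (b ^ (e / 2) % m) % m) b m, Nat.mod_mod]

/-- `powModFast (e+1) b e m = powMod b e m` (`e < 2^(e+1)`). [folklore] -/
theorem powModFast_succ_eq_powMod (b e m : ℕ) : powModFast (e + 1) b e m = powMod b e m := by
  rw [X11b.powMod_eq, powModFast_eq _ _ _ _ (Nat.lt_two_pow_self.trans (Nat.pow_lt_pow_right (by norm_num) (by omega)))]

/-- The Legendre symbol by Euler's criterion with `powModFast`. [folklore] -/
def legendreSymFast (a : ℤ) (ℓ : ℕ) : ℤ :=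
  let r := (a % (ℓ : ℤ)).toNat
  if r = 0 then 0 else if powModFast ((ℓ - 1) / 2 + 1) r ((ℓ - 1) / 2) ℓ = 1 then 1 else -1

/-- `legendreSymFast = legendreSym` (the schema's). [folklore] -/
theorem legendreSymFast_eq (a : ℤ) (ℓ : ℕ) :
    legendreSymFast a ℓ = X11RankOneCertificates.legendreSym a ℓ := by
  unfold legendreSymFast X11RankOneCertificates.legendreSym
  simp only [powModFast_succ_eq_powMod]

/-- `#E(𝔽_ℓ)` of `[a₁,…,a₆]` at an odd prime `ℓ` exactly as the schema's `countPoints`, with the Legendre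
symbols computed by `powModFast` (`≈ ℓ·log₂ ℓ` kernel multiplications instead of `≈ ℓ²/2`). [folklore] -/
def countPointsFast (a : List ℤ) (ℓ : ℕ) : ℤ :=
  match a with
  | [a1, a2, a3, a4, a6] =>
    1 + ((List.range ℓ).map fun (x : ℕ) =>
      1 + legendreSymFast ((a1 * x + a3) * (a1 * x + a3) + 4 * ((x : ℤ) * x * x + a2 * x * x + a4 * x + a6)) ℓ).sum
  | _ => 0

/-- **`countPointsFast = countPoints`.** [folklore] -/
theorem countPointsFast_eq (a : List ℤ) (ℓ : ℕ) : countPointsFast a ℓ = countPoints a ℓ := by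
  unfold countPointsFast countPoints
  split <;> simp only [legendreSymFast_eq]

/-- `countPoints a ℓ = n` from a `decide`d `countPointsFast a ℓ = n` — the form every record shape of the cell
consumes (`natCard_point_eq_of_countPoints`, `X6RankZero.bsdp_of_ainvs_of_certifiedL_of_LValueBall`, B's
`X7RankOne.bsdp_of_rem13_of_countPoints_…`). [folklore] -/
theorem countPoints_eq_of_fast {a : List ℤ} {ℓ : ℕ} {n : ℤ} (h : countPointsFast a ℓ = n) :
    countPoints a ℓ = n := by
  rw [← countPointsFast_eq]; exact h

/-- Sanity (`43314b1`, `ℓ = 251`): the fast count gives `260` (= the schema count). [folklore] -/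
theorem countPointsFast_sample : countPointsFast [1, 1, 0, -2916550, -1916874476] 251 = 260 := by
  decide +kernel

/-- The same at a level prime beyond the old ceiling (`236810a1`, `ℓ = 4759`, `#Ẽ(𝔽_4759) = 4849`,
implementation 3d's second level; PARI `ellgroup` ℤ/4849). [folklore] -/
theorem countPointsFast_sample_large :
    countPointsFast [1, 0, 1, -3898227707063, -2962435984809333492] 4759 = 4849 := by
  decide +kernel

end Summit.BirchSwinnertonDyer.Rank1Residual.Supersingular
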